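import Summits.Ventures.Crystal3D.Theorems.StickyWulffConstantGenericWallFloorHRowEndFarDefs
import HarnessLib

/-!
# `HRowEndFar` is FALSE: a lattice-coherent rising certified state sits at an h-row END ball
# (crux `GenericWallFloor`, stmt-Ventures-19480, kernel G; LAYER ROWS named input (J-b) of `…HRowEndFarDefs` p717949, registered in lane T's
#  `TexShadow` v8.13 as `stub_hRowEndFar`; refuted by the machine owner's successor seat 19480-p2 g14, 2026-08-29)

HONEST FRAMING. Venture `Summits/Ventures/Crystal3D` (cell `crystal3d-full`), route `route-Ventures-StickyWulffConstant`, helper for the crux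
`GenericWallFloor` (stmt-Ventures-19480) / consumer `TextureLiminfV5` (stmt-Ventures-23912).  ONE theorem, `not_hRowEndFar : ¬ HRowEndFar`
(plus private plumbing); standard axioms.  It KILLS the registered stub `stub_hRowEndFar : HRowEndFar` AS STATED — so R1
`barlow_layerRows_inPlane_at` (p721502) takes a false hypothesis and the LAYER ROWS line needs the REPAIRED input (apartness + regime
steepness, filed separately); F-C1 not moved.

THE WITNESS.  All twenty balls are sites of ONE ideal Barlow stacking with Hägg word `s k = −1 (k < 0), +1 (k ≥ 0)` (labels `L(−2) = 2,
L(−1) = 1, L(0) = 0, L(1) = 1`: layer `0` is an h-layer, layer `−1` a c-layer), so `1`-separation is the packing property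
`le_dist_barlowPos_of_ideal`.  Frame `F = id`, in-plane slot `u = (1,0,0)`, `p = 0` with its FULL anticuboctahedral dozen `hcpSlots`, row end
`e = p + u`.  The ball `z = basalMirror (½, √3/6, √(2/3))` of `p`'s lower triple touches `e` and carries the FULL cuboctahedral dozen
`z + F'·fccSlots` of `F' = −basalMirror` (half-turn about `e₃`; `F'·Λ₀` is the BASAL TWIN of `F·Λ₀`).  So the state `⟨F', q, 0⟩` with
`F' q = e − z = (½, −√3/6, √(2/3))` is strongly certified at `e` (full branch of `WalkCertified12`), `e + u ∉ X`, and for the unit vertical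
`ζ = (15/17, 0, 8/17)`: `⟪u, ζ⟫ = 15/17 ≥ √2/2` (indeed `≥ √(57/80)`, the edge-on regime's row steepness) while `⟪F' q, ζ⟫ = 15/34 + (8/17)√(2/3) ≥ 3/8`.

DIAGNOSIS (seat folder work/calc/, memo on the cell bus): exhaustively, every RIGID certified arrival at an h-row end is FORWARD
(`cos(F'q, Fu) ≤ −1/3`) or BASAL-COAXIAL (`F'·Λ₀ ∈ {F·Λ₀, (twinFrame F (F e₃))·Λ₀}`); the stack walk's pushed frames never carry those two
lattices (Σ3ⁿ chains do not return) and its bottom states are excluded by `not_walkCertified_bottom_of_hFull`.  The usable input is therefore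
`HRowEndFar` + APARTNESS + the regime steepness — a different statement, certified/proved separately.
-/

noncomputable section

namespace Summit.Ventures.Crystal3D.Theorems

open Finset
open Literature.MathematicalPhysics.StatisticalMechanics
open scoped InnerProductSpace

/-! ### The witness stacking: Hägg word `−1 | +1` and its labels -/

/-- The witness word is a Hägg sequence. -/
private theorem cexHagg_isHaggSeq : IsHaggSeq (fun k : ℤ => if k < 0 then -1 else 1) := by
  intro i
  by_cases h : i < 0 <;> simp [h]

/-- `L 1 = 1`. -/
private theorem cexLabel_one : haggLabel (fun k : ℤ => if k < 0 then -1 else 1) 1 = 1 := by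
  have h := haggLabel_succ (fun k : ℤ => if k < 0 then -1 else 1) 0
  simp at h
  simpa using h

/-- `L (−1) = 1` (layers `±1` aligned: layer `0` is an h-layer). -/
private theorem cexLabel_neg_one : haggLabel (fun k : ℤ => if k < 0 then -1 else 1) (-1) = 1 := by
  have h := haggLabel_succ (fun k : ℤ => if k < 0 then -1 else 1) (-1)
  simp at h
  linarith

/-- `L (−2) = 2` (layers `−2, 0` not aligned: layer `−1` is a c-layer). -/
private theorem cexLabel_neg_two : haggLabel (fun k : ℤ => if k < 0 then -1 else 1) (-2) = 2 := by
  have h := haggLabel_succ (fun k : ℤ => if k < 0 then -1 else 1) (-2)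
  have h1 := cexLabel_neg_one
  norm_num at h
  linarith

/-- Layers `0, 1` of `Λ₀` are layers `0, 1` of the witness stacking. -/
private theorem fcc_eq_cex {k : ℤ} (hk : k = 0 ∨ k = 1) (i j : ℤ) :
    barlowPos 1 (Real.sqrt (2 / 3)) constHagg k i j = barlowPos 1 (Real.sqrt (2 / 3)) (fun k : ℤ => if k < 0 then -1 else 1) k i j := by
  rcases hk with rfl | rfl
  · ext t; fin_cases t <;> simp
  · ext t; fin_cases t <;> simp [haggLabel_const, cexLabel_one]

/-- The basal mirror of layer `m ∈ {0, 1, 2}` of `Λ₀` is layer `−m` of the witness stacking. -/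
private theorem mirror_fcc_eq_cex {m : ℤ} (hm : m = 0 ∨ m = 1 ∨ m = 2) (i j : ℤ) :
    basalMirror (barlowPos 1 (Real.sqrt (2 / 3)) constHagg m i j) =
      barlowPos 1 (Real.sqrt (2 / 3)) (fun k : ℤ => if k < 0 then -1 else 1) (-m) i j := by
  rcases hm with rfl | rfl | rfl
  · ext t; fin_cases t <;> simp [basalMirror_apply_coord]
  · ext t; fin_cases t <;> simp [basalMirror_apply_coord, haggLabel_const, cexLabel_neg_one]
  · ext t; fin_cases t <;> simp [basalMirror_apply_coord, haggLabel_const, cexLabel_neg_two]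

/-- Every slot is `barlowPos` of a triple with `k ∈ {−1, 0, 1}`, and `k = −1` slots lie strictly below the basal plane. -/
private theorem slot_cases {w : EuclideanSpace ℝ (Fin 3)} (hw : w ∈ fccSlots) :
    ∃ k i j : ℤ, w = barlowPos 1 (Real.sqrt (2 / 3)) constHagg k i j ∧ (k = -1 ∨ k = 0 ∨ k = 1) := by
  rw [fccSlots, mem_image] at hw
  obtain ⟨c, hc, rfl⟩ := hw
  refine ⟨c.1, c.2.1, c.2.2, rfl, ?_⟩
  simp only [fccSlotTriples, mem_insert, mem_singleton] at hc
  rcases hc with rfl | rfl | rfl | rfl | rfl | rfl | rfl | rfl | rfl | rfl | rfl | rfl <;> simp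

/-- An upper slot (`w 2 ≥ 0`) has `k ∈ {0, 1}`. -/
private theorem upper_slot_cases {w : EuclideanSpace ℝ (Fin 3)} (hw : w ∈ fccSlots) (h2 : 0 ≤ w 2) :
    ∃ k i j : ℤ, w = barlowPos 1 (Real.sqrt (2 / 3)) constHagg k i j ∧ (k = 0 ∨ k = 1) := by
  obtain ⟨k, i, j, rfl, hk⟩ := slot_cases hw
  refine ⟨k, i, j, rfl, ?_⟩
  rcases hk with rfl | hk
  · exfalso
    rw [barlowPos_apply_two] at h2
    have : 0 < Real.sqrt (2 / 3) := Real.sqrt_pos.2 (by norm_num)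
    push_cast at h2
    linarith
  · exact hk

/-- The h-dozen `hcpSlots` lies in the witness stacking. -/
private theorem hcpSlots_sub_cex {w : EuclideanSpace ℝ (Fin 3)} (hw : w ∈ hcpSlots) :
    w ∈ barlowStacking 1 (Real.sqrt (2 / 3)) (fun k : ℤ => if k < 0 then -1 else 1) := by
  rcases mem_hcpSlots.1 hw with ⟨hw', hw2⟩ | ⟨t, ⟨ht, ht2⟩, rfl⟩
  · obtain ⟨k, i, j, rfl, hk⟩ := upper_slot_cases hw' hw2
    rw [fcc_eq_cex hk]
    exact barlowPos_mem _ _ _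
  · obtain ⟨k, i, j, rfl, hk⟩ := upper_slot_cases ht ht2
    rw [mirror_fcc_eq_cex (by rcases hk with h | h <;> simp [h])]
    exact barlowPos_mem _ _ _

/-- The `F'`-dozen of `z` lies in the witness stacking: `z + F' w = basalMirror ((½, √3/6, √(2/3)) − w)` is the mirror of an fcc site of layer
`1 − k ∈ {0, 1, 2}`. -/
private theorem zDozen_sub_cex {w : EuclideanSpace ℝ (Fin 3)} (hw : w ∈ fccSlots) :
    basalMirror (barlowPos 1 (Real.sqrt (2 / 3)) constHagg 1 0 0) + (basalMirror.trans (LinearIsometryEquiv.neg ℝ)) w ∈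
      barlowStacking 1 (Real.sqrt (2 / 3)) (fun k : ℤ => if k < 0 then -1 else 1) := by
  obtain ⟨k, i, j, rfl, hk⟩ := slot_cases hw
  have h1 : basalMirror (barlowPos 1 (Real.sqrt (2 / 3)) constHagg 1 0 0) +
      (basalMirror.trans (LinearIsometryEquiv.neg ℝ)) (barlowPos 1 (Real.sqrt (2 / 3)) constHagg k i j) =
      basalMirror (barlowPos 1 (Real.sqrt (2 / 3)) constHagg (1 - k) (0 - i) (0 - j)) := by
    rw [← barlowPos_fcc_sub, map_sub]
    simp [sub_eq_add_neg]
  rw [h1, mirror_fcc_eq_cex (by rcases hk with rfl | rfl | rfl <;> norm_num)]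
  exact barlowPos_mem _ _ _

/-! ### The refutation -/

/-- **`HRowEndFar` IS FALSE.**  Witness: `F = id`, `F' = −basalMirror`, `u = (1,0,0)`, `q` with `F' q = (½, −√3/6, √(2/3))`, `ζ = (15/17, 0, 8/17)`,
`X = hcpSlots ∪ (z + F'·fccSlots)` with `z = basalMirror (½, √3/6, √(2/3)) = e − F' q`, `e = u`, `p = e − u = 0`: `X` is `1`-separated (one Barlow
stacking), `p` is h-full, `e + u ∉ X`, the FULL branch of `WalkCertified12 X e ⟨F', q, 0⟩` holds, `⟪u, ζ⟫ = 15/17 ≥ √2/2` and `⟪F' q, ζ⟫ ≥ 3/8`. -/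
theorem not_hRowEndFar : ¬ HRowEndFar := by
  classical
  intro hJ
  -- data
  set hh : ℝ := Real.sqrt (2 / 3) with hhdef
  set F : EuclideanSpace ℝ (Fin 3) ≃ₗᵢ[ℝ] EuclideanSpace ℝ (Fin 3) := LinearIsometryEquiv.refl ℝ _ with hFdef
  set F' : EuclideanSpace ℝ (Fin 3) ≃ₗᵢ[ℝ] EuclideanSpace ℝ (Fin 3) := basalMirror.trans (LinearIsometryEquiv.neg ℝ) with hF'def
  set u : EuclideanSpace ℝ (Fin 3) := barlowPos 1 hh constHagg 0 1 0 with hudef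
  set q : EuclideanSpace ℝ (Fin 3) := barlowPos 1 hh constHagg 1 (-1) 0 with hqdef
  set z : EuclideanSpace ℝ (Fin 3) := basalMirror (barlowPos 1 hh constHagg 1 0 0) with hzdef
  set ζ : EuclideanSpace ℝ (Fin 3) := !₂[(15 : ℝ) / 17, 0, 8 / 17] with hζdef
  set X : Finset (EuclideanSpace ℝ (Fin 3)) := hcpSlots ∪ fccSlots.image (fun w => z + F' w) with hXdef
  have hhpos : 0 < hh := Real.sqrt_pos.2 (by norm_num)
  have hh2 : hh ^ 2 = 2 / 3 * 1 ^ 2 := by rw [hhdef, Real.sq_sqrt (by norm_num)]; ring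
  have hF'c : ∀ (x : EuclideanSpace ℝ (Fin 3)) (t : Fin 3), F' x t = -(basalMirror x t) := fun x t => by simp [hF'def]
  -- X lies in the witness stacking, hence is 1-separated
  have hXsub : ∀ x ∈ X, x ∈ barlowStacking 1 hh (fun k : ℤ => if k < 0 then -1 else 1) := by
    intro x hx
    rcases mem_union.1 hx with hx | hx
    · exact hcpSlots_sub_cex hx
    · obtain ⟨w, hw, rfl⟩ := mem_image.1 hx
      exact zDozen_sub_cex hw
  have hX : ∀ p ∈ X, ∀ p' ∈ X, p ≠ p' → 1 ≤ dist p p' := by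
    intro p hp p' hp' hne
    obtain ⟨k, i, j, rfl⟩ := hXsub p hp
    obtain ⟨k', i', j', rfl⟩ := hXsub p' hp'
    refine le_dist_barlowPos_of_ideal cexHagg_isHaggSeq one_pos hh2 ?_
    rintro heq
    simp only [Prod.mk.injEq] at heq
    obtain ⟨rfl, rfl, rfl⟩ := heq
    exact hne rfl
  -- the slots used
  have hu : u ∈ fccSlots := by
    rw [hudef, hhdef, fccSlots, mem_image]; exact ⟨(0, 1, 0), by simp [fccSlotTriples], rfl⟩
  have hq : q ∈ fccSlots := by
    rw [hqdef, hhdef, fccSlots, mem_image]; exact ⟨(1, -1, 0), by simp [fccSlotTriples], rfl⟩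
  have h100 : barlowPos 1 hh constHagg 1 0 0 ∈ fccSlots := by
    rw [hhdef, fccSlots, mem_image]; exact ⟨(1, 0, 0), by simp [fccSlotTriples], rfl⟩
  have hu2 : u 2 = 0 := by rw [hudef, barlowPos_apply_two]; simp
  have heFu : u - F u = 0 := by simp [hFdef]
  -- the vertical ζ
  have hζ : ‖ζ‖ = 1 := by
    rw [hζdef, EuclideanSpace.norm_eq, Fin.sum_univ_three]
    simp
    norm_num
  have hsteep : Real.sqrt 2 / 2 ≤ ⟪F u, ζ⟫_ℝ := by
    have h1 : ⟪F u, ζ⟫_ℝ = 15 / 17 := by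
      rw [hFdef, LinearIsometryEquiv.coe_refl, id, hudef, hζdef, EuclideanSpace.inner_eq_star_dotProduct]
      simp [Fin.sum_univ_three, dotProduct]
    rw [h1]
    have h2 : Real.sqrt 2 ≤ 30 / 17 := by
      rw [Real.sqrt_le_left (by norm_num)]; norm_num
    linarith
  have hrise : (3 : ℝ) / 8 ≤ ⟪F' q, ζ⟫_ℝ := by
    have h1 : ⟪F' q, ζ⟫_ℝ = 15 / 34 + 8 / 17 * hh := by
      rw [EuclideanSpace.inner_eq_star_dotProduct]
      simp [Fin.sum_univ_three, dotProduct, hF'c, basalMirror_apply_coord, hqdef, hζdef, haggLabel_const]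
      ring
    rw [h1]
    nlinarith
  -- e ∈ X, p = 0 ∈ X, p h-full
  have he : u ∈ X := mem_union_left _ (mem_hcpSlots_of_inPlane hu hu2)
  have hp : u - F u ∈ X := by
    rw [heFu]
    refine mem_union_right _ (mem_image.2 ⟨_, h100, ?_⟩)
    rw [hzdef]
    ext t; fin_cases t <;> simp [hF'c]
  have hfull : ∀ w ∈ hcpSlots, u - F u + F w ∈ X := by
    intro w hw
    rw [heFu, zero_add, hFdef, LinearIsometryEquiv.coe_refl, id]
    exact mem_union_left _ hw
  -- e's own h-dozen is not full: e + u ∉ X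
  have hvac : ∃ w ∈ hcpSlots, u + F w ∉ X := by
    refine ⟨u, mem_hcpSlots_of_inPlane hu hu2, fun hmem => ?_⟩
    rw [hFdef, LinearIsometryEquiv.coe_refl, id] at hmem
    have hnorm2 : ‖u + u‖ = 2 := by
      rw [← two_smul ℝ u, norm_smul, norm_eq_one_of_mem_fccSlots hu]; norm_num
    rcases mem_union.1 hmem with h | h
    · have := norm_eq_one_of_mem_hcpSlots h
      linarith
    · obtain ⟨w, hw, hzw⟩ := mem_image.1 h
      have hn1 : ‖F' w‖ = 1 := by rw [LinearIsometryEquiv.norm_map, norm_eq_one_of_mem_fccSlots hw]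
      have hFw : F' w = u + u - z := by rw [← hzw]; abel
      have hsq : ‖u + u - z‖ ^ 2 = 3 := by
        rw [EuclideanSpace.norm_sq_eq, Fin.sum_univ_three]
        simp only [Real.norm_eq_abs, sq_abs]
        simp [hudef, hzdef, basalMirror_apply_coord, haggLabel_const]
        have h3 : Real.sqrt 3 ^ 2 = 3 := Real.sq_sqrt (by norm_num)
        have h23 : hh ^ 2 = 2 / 3 := by rw [hh2]; ring
        nlinarith [h3, h23]
      rw [hFw] at hn1
      nlinarith [hn1, hsq]
  -- the strongly certified RISING state at e: FULL branch, predecessor z = e − F' q with its whole F'-dozen in X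
  have hz : u - F' q = z := by
    ext t; fin_cases t <;> simp [hF'c, basalMirror_apply_coord, hudef, hqdef, hzdef, haggLabel_const]
  have hcert : WalkCertified12 X u ⟨F', q, 0⟩ := by
    refine Or.inl ⟨?_, fun w hw => ?_⟩
    · show u - F' q ∈ X
      rw [hz]
      exact mem_union_left _ (basalMirror_mem_hcpSlots_of_upper h100 (by rw [barlowPos_apply_two]; simp [hhpos.le]))
    · show u - F' q + F' w ∈ X
      rw [hz]
      exact mem_union_right _ (mem_image_of_mem _ hw)
  exact hJ F F' u hu hu2 q hq ζ hζ hsteep hrise X hX u he hp hfull hvac hcert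

end Summit.Ventures.Crystal3D.Theorems

end
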